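import Mathlib
import Literature.Probability.Percolation.PercolationProofs
import Summits.CriticalPhenomena.PercolationContinuityZ3.Theorems.PercNearOneGluingAdditiveGluingGoodBase
import Summits.CriticalPhenomena.PercolationContinuityZ3.Theorems.PercNearOneGluingAdditiveGluingLemma5AnyRelay
import HarnessLib

/-! # Crux `PercNearOneGluing.AdditiveGluing` (stmt-CriticalPhenomena-4576), line `subuniform-dead-pocket-maximum` —
# the inductive step `stub_goodStep` reduces to LEVEL-SET relay sets (relay monotonicity of goodness)

Helper file for the crux skeleton `Cruxes/AdditiveGluing/Lines/subuniform-dead-pocket-maximum.lean`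
(siege seat k38, variation "general `|A ∖ b|`").  Notation: `μ = prodBernoulli w`, `τ(x) = μ(x ↔ b)`,
`C(o) = openCluster · o`, and for a relay set `S ∋ b`, a level `t` and a selection `sel`,
`LHS(S) := μ(o ↔ S, o ↮ b) + Σ_{W ∋ o, W ∩ S = ∅} μ(C(o) = W) · μ((sel W ↔ b in Wᶜ)ᶜ)`
(live failure + selected dead-pocket penalty; `GOOD(S)` at `(t, sel)` is `LHS(S) ≤ t`).

* `goodLevel_lhs_insert` — **relay monotonicity**: for `b ∈ A` and any `c`, `LHS(A) ≤ LHS(A ∪ {c})`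
  (same `t`, same `sel`).  Adding a relay `c` turns the dead pockets `W ∋ c` into live failures: their
  penalty `μ(C(o)=W)·μ(…ᶜ) ≤ μ(C(o)=W)` is dominated by the mass they add to the live failure, because the
  fibres `{C(o) = W}`, `W ∋ c`, `W ∩ A = ∅`, are pairwise disjoint, disjoint from `{o ↔ A}`, and contained in
  `{o ↔ c} ∩ {o ↮ b}`.  Hence `GOOD(A ∪ {c}) ⟹ GOOD(A)` whenever `t` is admissible for `c`; iterating
  (`goodLevel_lhs_union`), goodness of the LEVEL SET `L_t = {v | 1 − t ≤ τ(v)}` gives goodness of every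
  `A ⊆ L_t` — the penalised form of Kozma–Nitzan's reduction §5.6(4) (arXiv:2401.12397 p. 36), now INSIDE
  the induction of the line.
* `goodLevel_lhs_le` — the trivial bound `LHS(A) ≤ μ(o ↮ b)` (so `GOOD` is trivial when `τ(o) ≥ 1 − t`).
* `stub_goodStepOfLevelStep_k38` (registered helper stub) — **`stub_goodStep` follows from its level-set special case**:
  it suffices to prove the step for the relay set `L_t` itself, for observers `o` with `τ(o) < 1 − t` that
  have a positive-weight neighbour OUTSIDE `L_t` (in that normal form every non-relay vertex, `o` included,
  is strictly less reliable than every relay).  Observers whose low neighbours all lie in `L_t` are covered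
  by the landed base case `stub_goodBase` + `stub_lemma5AnyRelay` (KN Thm 4), and `A ⊆ L_t` by monotonicity.

No new definitions; nothing here asserts the stub. -/

namespace Summit.CriticalPhenomena.PercolationContinuityZ3.Theorems

open MeasureTheory Set
open Literature.Probability.LatticeModels (prodBernoulli)
open Literature.Probability.Percolation (BondConfig openConn openConnIn openGraph openCluster)
open scoped BigOperators

noncomputable section
open Classical

variable {n : ℕ}

/-- The fibres `{C(o) = W}` of the cluster map are pairwise disjoint. [folklore] -/
theorem goodLevel_fibre_disjoint (o : Fin n) (F : Finset (Finset (Fin n))) :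
    (F : Set (Finset (Fin n))).PairwiseDisjoint
      (fun W : Finset (Fin n) => {ω : BondConfig (Fin n) | openCluster ω o = (W : Set (Fin n))}) := by
  intro W _ W' _ hne
  refine Set.disjoint_left.2 fun ω hω hω' => hne ?_
  have h : ((W : Set (Fin n))) = (W' : Set (Fin n)) := by
    rw [← (hω : openCluster ω o = (W : Set (Fin n))), ← (hω' : openCluster ω o = (W' : Set (Fin n)))]
  exact Finset.coe_injective h

/-- Sum of fibre masses = mass of their union, bounded by any superset. [folklore] -/
theorem goodLevel_sum_fibre_le (w : Sym2 (Fin n) → unitInterval) (o : Fin n) (F : Finset (Finset (Fin n)))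
    (E : Set (BondConfig (Fin n)))
    (hE : ∀ W ∈ F, {ω : BondConfig (Fin n) | openCluster ω o = (W : Set (Fin n))} ⊆ E) :
    ∑ W ∈ F, (prodBernoulli w).real {ω : BondConfig (Fin n) | openCluster ω o = (W : Set (Fin n))} ≤
      (prodBernoulli w).real E := by
  rw [← measureReal_biUnion_finset (goodLevel_fibre_disjoint o F)
    (fun W _ => (Set.toFinite _).measurableSet)]
  exact measureReal_mono (Set.iUnion₂_subset hE)

/-- **The trivial bound** `LHS(A) ≤ μ(o ↮ b)` for `b ∈ A`: the live failure lies in `{o ↮ b}`, the dead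
fibres `{C(o) = W}` (`W ∋ o`, `W ∩ A = ∅`, so `b ∉ W`) lie in `{o ↮ b}` too, are pairwise disjoint and
disjoint from the live failure, and each penalty factor is `≤ 1`. [folklore] -/
theorem goodLevel_lhs_le (w : Sym2 (Fin n) → unitInterval) (A : Finset (Fin n)) (o b : Fin n)
    (hbA : b ∈ A) (sel : Finset (Fin n) → Fin n) :
    (prodBernoulli w).real ((⋃ a ∈ A, openConn o a) ∩ (openConn o b)ᶜ)
        + ∑ W ∈ (Finset.univ : Finset (Finset (Fin n))).filter (fun W => o ∈ W ∧ Disjoint W A),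
            (prodBernoulli w).real {ω : BondConfig (Fin n) | openCluster ω o = (W : Set (Fin n))}
              * (prodBernoulli w).real (openConnIn ((W : Set (Fin n))ᶜ) (sel W) b)ᶜ ≤
      (prodBernoulli w).real (openConn o b : Set (BondConfig (Fin n)))ᶜ := by
  set F := (Finset.univ : Finset (Finset (Fin n))).filter (fun W => o ∈ W ∧ Disjoint W A) with hF
  -- penalty factors are at most `1`
  have hpen : ∑ W ∈ F, (prodBernoulli w).real {ω : BondConfig (Fin n) | openCluster ω o = (W : Set (Fin n))}
        * (prodBernoulli w).real (openConnIn ((W : Set (Fin n))ᶜ) (sel W) b)ᶜ ≤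
      ∑ W ∈ F, (prodBernoulli w).real {ω : BondConfig (Fin n) | openCluster ω o = (W : Set (Fin n))} :=
    Finset.sum_le_sum fun W _ => mul_le_of_le_one_right measureReal_nonneg measureReal_le_one
  -- the dead fibres lie in `{o ↮ b} \ {o ↔ A}`
  have hdead : ∀ W ∈ F, {ω : BondConfig (Fin n) | openCluster ω o = (W : Set (Fin n))} ⊆
      (openConn o b : Set (BondConfig (Fin n)))ᶜ \ ((⋃ a ∈ A, openConn o a) ∩ (openConn o b)ᶜ) := by
    intro W hW ω hω
    rw [hF, Finset.mem_filter] at hW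
    have hω' : openCluster ω o = (W : Set (Fin n)) := hω
    have hnot : ∀ a ∈ A, ω ∉ (openConn o a : Set (BondConfig (Fin n))) := by
      intro a ha hoa
      have haC : a ∈ openCluster ω o := hoa
      rw [hω'] at haC
      exact Finset.disjoint_left.1 hW.2.2 (Finset.mem_coe.1 haC) ha
    refine ⟨hnot b hbA, fun h => ?_⟩
    obtain ⟨a, ha, hωa⟩ := Set.mem_iUnion₂.1 h.1
    exact hnot a ha hωa
  have hsum := goodLevel_sum_fibre_le w o F _ hdead
  have hsplit : (prodBernoulli w).real
        ((openConn o b : Set (BondConfig (Fin n)))ᶜ \ ((⋃ a ∈ A, openConn o a) ∩ (openConn o b)ᶜ)) =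
      (prodBernoulli w).real (openConn o b : Set (BondConfig (Fin n)))ᶜ -
        (prodBernoulli w).real ((⋃ a ∈ A, openConn o a) ∩ (openConn o b)ᶜ) :=
    measureReal_sdiff Set.inter_subset_right (Set.toFinite _).measurableSet
  linarith

/-- **Relay monotonicity of goodness** (one relay): for `b ∈ A` and any vertex `c`, `LHS(A) ≤ LHS(A ∪ {c})`
at the same level and selection (for `c = o` the right side is just `μ(o ↮ b)`).  The dead pockets of `A` split into those avoiding `c` (= the dead pockets of
`A ∪ {c}`) and those containing `c`; the latter have penalty factor `≤ 1`, their fibres are pairwise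
disjoint, disjoint from the live failure `{o ↔ A, o ↮ b}` and contained in the live failure of `A ∪ {c}`.
[penalised form of Kozma–Nitzan arXiv:2401.12397 §5.6(4)] -/
theorem goodLevel_lhs_insert (w : Sym2 (Fin n) → unitInterval) (A : Finset (Fin n)) (o b c : Fin n)
    (hbA : b ∈ A) (sel : Finset (Fin n) → Fin n) :
    (prodBernoulli w).real ((⋃ a ∈ A, openConn o a) ∩ (openConn o b)ᶜ)
        + ∑ W ∈ (Finset.univ : Finset (Finset (Fin n))).filter (fun W => o ∈ W ∧ Disjoint W A),
            (prodBernoulli w).real {ω : BondConfig (Fin n) | openCluster ω o = (W : Set (Fin n))}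
              * (prodBernoulli w).real (openConnIn ((W : Set (Fin n))ᶜ) (sel W) b)ᶜ ≤
      (prodBernoulli w).real ((⋃ a ∈ insert c A, openConn o a) ∩ (openConn o b)ᶜ)
        + ∑ W ∈ (Finset.univ : Finset (Finset (Fin n))).filter (fun W => o ∈ W ∧ Disjoint W (insert c A)),
            (prodBernoulli w).real {ω : BondConfig (Fin n) | openCluster ω o = (W : Set (Fin n))}
              * (prodBernoulli w).real (openConnIn ((W : Set (Fin n))ᶜ) (sel W) b)ᶜ := by
  set F := (Finset.univ : Finset (Finset (Fin n))).filter (fun W => o ∈ W ∧ Disjoint W A) with hF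
  set f : Finset (Fin n) → ℝ := fun W =>
    (prodBernoulli w).real {ω : BondConfig (Fin n) | openCluster ω o = (W : Set (Fin n))}
      * (prodBernoulli w).real (openConnIn ((W : Set (Fin n))ᶜ) (sel W) b)ᶜ with hf
  -- split the dead pockets of `A` according to `c ∈ W`
  have hsplit : ∑ W ∈ F, f W = ∑ W ∈ F.filter (fun W => c ∈ W), f W + ∑ W ∈ F.filter (fun W => c ∉ W), f W :=
    (Finset.sum_filter_add_sum_filter_not F (fun W => c ∈ W) f).symm
  have hF' : F.filter (fun W => c ∉ W) =
      (Finset.univ : Finset (Finset (Fin n))).filter (fun W => o ∈ W ∧ Disjoint W (insert c A)) := by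
    ext W
    simp only [hF, Finset.mem_filter, Finset.mem_univ, true_and, Finset.disjoint_insert_right]
    tauto
  -- pockets containing `c`: penalty factor `≤ 1`, fibres inside the new live failure, off the old one
  have h1 : ∑ W ∈ F.filter (fun W => c ∈ W), f W ≤
      ∑ W ∈ F.filter (fun W => c ∈ W),
        (prodBernoulli w).real {ω : BondConfig (Fin n) | openCluster ω o = (W : Set (Fin n))} :=
    Finset.sum_le_sum fun W _ => mul_le_of_le_one_right measureReal_nonneg measureReal_le_one
  have hsub : ∀ W ∈ F.filter (fun W => c ∈ W),
      {ω : BondConfig (Fin n) | openCluster ω o = (W : Set (Fin n))} ⊆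
        ((⋃ a ∈ insert c A, openConn o a) ∩ (openConn o b)ᶜ) \ ((⋃ a ∈ A, openConn o a) ∩ (openConn o b)ᶜ) := by
    intro W hW ω hω
    rw [Finset.mem_filter, hF, Finset.mem_filter] at hW
    have hω' : openCluster ω o = (W : Set (Fin n)) := hω
    have hnot : ∀ a ∈ A, ω ∉ (openConn o a : Set (BondConfig (Fin n))) := by
      intro a ha hoa
      have haC : a ∈ openCluster ω o := hoa
      rw [hω'] at haC
      exact Finset.disjoint_left.1 hW.1.2.2 (Finset.mem_coe.1 haC) ha
    have hoc : ω ∈ (openConn o c : Set (BondConfig (Fin n))) := by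
      show c ∈ openCluster ω o
      rw [hω']
      exact Finset.mem_coe.2 hW.2
    refine ⟨⟨Set.mem_iUnion₂.2 ⟨c, Finset.mem_insert_self c A, hoc⟩, hnot b hbA⟩, fun h => ?_⟩
    obtain ⟨a, ha, hωa⟩ := Set.mem_iUnion₂.1 h.1
    exact hnot a ha hωa
  have h2 := goodLevel_sum_fibre_le w o (F.filter (fun W => c ∈ W)) _ hsub
  have hmono : ((⋃ a ∈ A, openConn o a) ∩ (openConn o b)ᶜ : Set (BondConfig (Fin n))) ⊆
      (⋃ a ∈ insert c A, openConn o a) ∩ (openConn o b)ᶜ :=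
    Set.inter_subset_inter_left _ (Set.biUnion_subset_biUnion_left fun a ha => Finset.mem_insert_of_mem ha)
  have hdiff : (prodBernoulli w).real
        (((⋃ a ∈ insert c A, openConn o a) ∩ (openConn o b)ᶜ) \ ((⋃ a ∈ A, openConn o a) ∩ (openConn o b)ᶜ)) =
      (prodBernoulli w).real ((⋃ a ∈ insert c A, openConn o a) ∩ (openConn o b)ᶜ) -
        (prodBernoulli w).real ((⋃ a ∈ A, openConn o a) ∩ (openConn o b)ᶜ) :=
    measureReal_sdiff hmono (Set.toFinite _).measurableSet
  rw [hsplit, hF']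
  linarith

/-- **Relay monotonicity of goodness** (a set of extra relays): for `b ∈ A`, `LHS(A) ≤ LHS(A ∪ S)`;
by induction on `S` from `goodLevel_lhs_insert`. -/
theorem goodLevel_lhs_union (w : Sym2 (Fin n) → unitInterval) (A : Finset (Fin n)) (o b : Fin n)
    (hbA : b ∈ A) (sel : Finset (Fin n) → Fin n) (S : Finset (Fin n)) :
    (prodBernoulli w).real ((⋃ a ∈ A, openConn o a) ∩ (openConn o b)ᶜ)
        + ∑ W ∈ (Finset.univ : Finset (Finset (Fin n))).filter (fun W => o ∈ W ∧ Disjoint W A),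
            (prodBernoulli w).real {ω : BondConfig (Fin n) | openCluster ω o = (W : Set (Fin n))}
              * (prodBernoulli w).real (openConnIn ((W : Set (Fin n))ᶜ) (sel W) b)ᶜ ≤
      (prodBernoulli w).real ((⋃ a ∈ A ∪ S, openConn o a) ∩ (openConn o b)ᶜ)
        + ∑ W ∈ (Finset.univ : Finset (Finset (Fin n))).filter (fun W => o ∈ W ∧ Disjoint W (A ∪ S)),
            (prodBernoulli w).real {ω : BondConfig (Fin n) | openCluster ω o = (W : Set (Fin n))}
              * (prodBernoulli w).real (openConnIn ((W : Set (Fin n))ᶜ) (sel W) b)ᶜ := by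
  induction S using Finset.induction_on with
  | empty => simp
  | @insert c S _ ih =>
    have hbAS : b ∈ A ∪ S := Finset.mem_union_left S hbA
    have h := goodLevel_lhs_insert w (A ∪ S) o b c hbAS sel
    rw [Finset.union_insert]
    exact ih.trans h

/-- **`stub_goodStep` reduces to level sets.**  Suppose the inductive step is known for LEVEL-SET relay sets:
for all `n w o b t sel`, if `0 ≤ t`, `τ(o) < 1 − t` (so `o ∉ L_t := {v | 1 − t ≤ τ(v)} ∋ b`), `o` has a
positive-weight neighbour `y ≠ o` outside `L_t`, goodness holds for every weight function with fewer
positive-degree vertices (the induction hypothesis of the line, verbatim), and `sel` selects in `L_t`, then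
`LHS(L_t) ≤ t`.  Then the registered stub `stub_goodStep` holds (verbatim signature as conclusion).
Proof: if `1 − t ≤ τ(o)` use `goodLevel_lhs_le`; otherwise `A ⊆ L_t ∌ o`, and `LHS(A) ≤ LHS(L_t) ≤ t` by
`goodLevel_lhs_union` and either the hypothesis (a low neighbour outside `L_t`) or the landed base case
`stub_goodBase stub_lemma5AnyRelay` (every positive-weight neighbour of `o` inside `L_t`; KN Thm 4). -/
theorem stub_goodStepOfLevelStep_k38 :
    (∀ (n : ℕ) (w : Sym2 (Fin n) → unitInterval) (o b : Fin n) (t : ℝ) (sel : Finset (Fin n) → Fin n), 0 ≤ t → (prodBernoulli w).real (openConn o b) < 1 - t → (∃ y : Fin n, ¬ (1 - t ≤ (prodBernoulli w).real (openConn y b)) ∧ y ≠ o ∧ (w s(o, y) : ℝ) ≠ 0) → (∀ w' : Sym2 (Fin n) → unitInterval, (Finset.univ.filter (fun v : Fin n => ∃ u : Fin n, 0 < (w' s(u, v) : ℝ))).card < (Finset.univ.filter (fun v : Fin n => ∃ u : Fin n, 0 < (w s(u, v) : ℝ))).card → ∀ (A' : Finset (Fin n)) (o' b' : Fin n), b'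 ∈ A' → o' ∉ A' → ∀ (t : ℝ) (sel : Finset (Fin n) → Fin n), (∀ W, sel W ∈ A') → (∀ a ∈ A', 1 - t ≤ (prodBernoulli w').real (openConn a b')) → (prodBernoulli w').real ((⋃ a ∈ A', openConn o' a) ∩ (openConn o' b')ᶜ) + ∑ W ∈ (Finset.univ : Finset (Finset (Fin n))).filter (fun W => o' ∈ W ∧ Disjoint W A'), (prodBernoulli w').real {ω : BondConfig (Fin n) | openCluster ω o' = (W : Set (Fin n))} * (prodBernoulli w').real (openConnIn ((W : Set (Fin n))ᶜ) (sel W) b')ᶜ ≤ t) → (∀ W, 1 - t ≤ (prodBernoulli w).real (openConn (sel W) b)) → (prodBernoulli w).real ((⋃ a ∈ Finset.univ.filter (fun v : Fin n => 1 - t ≤ (prodBernoulli w).real (openConn v b)), openConn o a) ∩ (openConn o b)ᶜ) + ∑ W ∈ (Finset.univ : Finset (Finset (Fin n))).filter (fun W => o ∈ W ∧ Disjoint W (Finset.univ.filter (fun v : Fin n => 1 - t ≤ (prodBernoulli w).real (openConn v b)))), (prodBernoulli w).real {ω : BondConfig (Fin n) | openCluster ω o = (W : Set (Fin n))} * (prodBernoulli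 w).real (openConnIn ((W : Set (Fin n))ᶜ) (sel W) b)ᶜ ≤ t) → ∀ (n : ℕ) (w : Sym2 (Fin n) → unitInterval) (A : Finset (Fin n)) (o b : Fin n), b ∈ A → o ∉ A → (∃ y : Fin n, y ∉ A ∧ y ≠ o ∧ (w s(o, y) : ℝ) ≠ 0) → (∀ w' : Sym2 (Fin n) → unitInterval, (Finset.univ.filter (fun v : Fin n => ∃ u : Fin n, 0 < (w' s(u, v) : ℝ))).card < (Finset.univ.filter (fun v : Fin n => ∃ u : Fin n, 0 < (w s(u, v) : ℝ))).card → ∀ (A' : Finset (Fin n)) (o' b' : Fin n), b' ∈ A' → o' ∉ A' → ∀ (t : ℝ) (sel : Finset (Fin n) → Fin n), (∀ W, sel W ∈ A') → (∀ a ∈ A', 1 - t ≤ (prodBernoulli w').real (openConn a b')) → (prodBernoulli w').real ((⋃ a ∈ A', openConn o' a) ∩ (openConn o' b')ᶜ) + ∑ W ∈ (Finset.univ : Finset (Finset (Fin n))).filter (fun W => o' ∈ W ∧ Disjoint W A'), (prodBernoulli w').real {ω : BondConfig (Fin n) | openCluster ω o' = (W : Set (Fin n))} * (prodBernoulli w').real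 (openConnIn ((W : Set (Fin n))ᶜ) (sel W) b')ᶜ ≤ t) → ∀ (t : ℝ) (sel : Finset (Fin n) → Fin n), (∀ W, sel W ∈ A) → (∀ a ∈ A, 1 - t ≤ (prodBernoulli w).real (openConn a b)) → (prodBernoulli w).real ((⋃ a ∈ A, openConn o a) ∩ (openConn o b)ᶜ) + ∑ W ∈ (Finset.univ : Finset (Finset (Fin n))).filter (fun W => o ∈ W ∧ Disjoint W A), (prodBernoulli w).real {ω : BondConfig (Fin n) | openCluster ω o = (W : Set (Fin n))} * (prodBernoulli w).real (openConnIn ((W : Set (Fin n))ᶜ) (sel W) b)ᶜ ≤ t := by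
  intro hlev n w A o b hbA hoA hy IH t sel hsel hA
  -- `t ≥ 0` from the relay hypothesis at `b`
  have hbb : (prodBernoulli w).real (openConn b b : Set (BondConfig (Fin n))) = 1 := by
    have h : (openConn b b : Set (BondConfig (Fin n))) = Set.univ :=
      Set.eq_univ_of_forall fun ω => (SimpleGraph.Reachable.refl b : (openGraph ω).Reachable b b)
    rw [h, probReal_univ]
  have ht0 : 0 ≤ t := by have := hA b hbA; rw [hbb] at this; linarith
  by_cases hto : 1 - t ≤ (prodBernoulli w).real (openConn o b)
  · -- trivial case: `LHS(A) ≤ μ(o ↮ b) = 1 − τ(o) ≤ t`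
    have h := goodLevel_lhs_le w A o b hbA sel
    rw [probReal_compl_eq_one_sub (Set.toFinite _).measurableSet] at h
    linarith
  push Not at hto
  -- the level set `L = {v | 1 − t ≤ τ(v)}`: `A ⊆ L`, `o ∉ L`, `b ∈ L`
  set L := Finset.univ.filter (fun v : Fin n => 1 - t ≤ (prodBernoulli w).real (openConn v b)) with hL
  have hAL : A ⊆ L := fun a ha => Finset.mem_filter.2 ⟨Finset.mem_univ _, hA a ha⟩
  have hoL : o ∉ L := fun h => by
    have := (Finset.mem_filter.1 h).2
    linarith
  have hbL : b ∈ L := hAL hbA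
  have hLmem : ∀ x ∈ L, 1 - t ≤ (prodBernoulli w).real (openConn x b) := fun x hx => (Finset.mem_filter.1 hx).2
  have hselL : ∀ W, sel W ∈ L := fun W => hAL (hsel W)
  -- goodness of the level set: the hypothesis, or the base case when `o` has no low neighbour outside `L`
  have hgoodL : (prodBernoulli w).real ((⋃ a ∈ L, openConn o a) ∩ (openConn o b)ᶜ)
        + ∑ W ∈ (Finset.univ : Finset (Finset (Fin n))).filter (fun W => o ∈ W ∧ Disjoint W L),
            (prodBernoulli w).real {ω : BondConfig (Fin n) | openCluster ω o = (W : Set (Fin n))}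
              * (prodBernoulli w).real (openConnIn ((W : Set (Fin n))ᶜ) (sel W) b)ᶜ ≤ t := by
    by_cases hlow : ∃ y : Fin n, y ∉ L ∧ y ≠ o ∧ (w s(o, y) : ℝ) ≠ 0
    · obtain ⟨y, hyL, hyo, hy0⟩ := hlow
      have hyL' : ¬ (1 - t ≤ (prodBernoulli w).real (openConn y b)) := fun h =>
        hyL (Finset.mem_filter.2 ⟨Finset.mem_univ _, h⟩)
      exact hlev n w o b t sel ht0 hto ⟨y, hyL', hyo, hy0⟩ IH (fun W => hLmem _ (hselL W))
    · push Not at hlow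
      exact stub_goodBase stub_lemma5AnyRelay n w L o b hbL hoL hlow t sel hselL hLmem
  -- monotonicity from `A` up to `L = A ∪ (L \ A)`
  have hmono := goodLevel_lhs_union w A o b hbA sel (L \ A)
  rw [Finset.union_sdiff_of_subset hAL] at hmono
  exact hmono.trans hgoodL

end

end Summit.CriticalPhenomena.PercolationContinuityZ3.Theorems
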